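import Summits.CriticalPhenomena.PercolationContinuityZ3.Theorems.SahiMasterFamilyShrunkFrameZeros

/-!
# The order-five step, equality half: (EQ-5) on every 5-family of increasing events with a `Z_4` sub-family

Unit `prim-master-conj` (crux anchor stmt-CriticalPhenomena-4575).  `SahiMasterFamilyFiveStep.lean` proved the positivity half
`E_5(μ_p; U) ≥ 0` for five increasing events containing a `Z_4` sub-family.  This file proves the EQUALITY half: for `p` in the open
cube, `E_5(μ_p; U) = 0 ↔ U ∈ Z_5` (`sahiE_five_ind_eq_zero_iff_of_zeroFlagQuadruple`) — i.e. `masterFamily_step` at `k = 5` with BOTH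
order-four hypotheses (`MasterFamilyNonneg 4`, `MasterFamilyEqIff 4`) removed (`masterFamily_step_five`).  Route (K4-NOTES §12 of the
unit): peel the free slot, `E_5(U) = Σ_l E_4(U_{−m} with U_l ↦ U_l ∩ U_m)` (`sahiE_ind_step`); by the structure of `Z_4`
(`supports_of_sahiE_four_eq_zero`: case (a) frame `(X, Y, K)` with the fourth member pairwise-sandwiched, case (b) two members
`Z_3`-sandwiched over `(X, Y)` with independent hulls) each of the four order-four families either keeps a `Z_3` sub-triple
(`sahiE_four_ind_nonneg_of_zeroFlagTriple` / `…_eq_zero_iff_…`) or is one of the two shrunk frames of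
`SahiMasterFamilyShrunkFrames.lean` / `SahiMasterFamilyShrunkFramePairwise.lean`, nonnegative, and by the zero analysis of
`SahiMasterFamilyShrunkFrameZeros.lean` in `Z_4` as soon as it vanishes.  So `E_5 = 0` forces every modified family into `Z_4`,
which is `Z_5` via the peeled slot.  Consequences: `masterFamilyEqIff_five_iff` (`MasterFamilyEqIff 5` ⟺ "an interior zero of `E_5`
forces a `Z_4` sub-family") and `masterFamilyIdentEqIff_five_iff` ((EQI-5) ⟺ **(T₅)**: five increasing events with no `Z_4` sub-family
have `E_5(μ_p) ≠ 0` for some interior `p`).  No conjecture asserted; axioms standard. [this work]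
-/

noncomputable section

open scoped Classical

namespace Summit.CriticalPhenomena.PercolationContinuityZ3.Theorems

open Finset Function MeasureTheory
open Literature.Combinatorics.Sahi2008
open Literature.Probability.Percolation (DeterminedBy)
open Literature.Probability.LatticeModels (prodBernoulli)
open Literature.Probability.LatticeModels.Kahn2022 (Affects)
open Literature.Probability.Percolation.DecisionTree (ind ind_of_mem ind_of_not_mem ind_nonneg)

section Events

variable {ι : Type} [Fintype ι]

/-- The four slots of `Fin 4` seen from `i` and then `i' : Fin 3`: `i`, `i.succAbove i'`, `i.succAbove (i'.succAbove 0)`,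
`i.succAbove (i'.succAbove 1)`. [folklore] -/
theorem fin_four_slot_cases (l i : Fin 4) (i' : Fin 3) :
    l = i ∨ l = i.succAbove i' ∨ l = i.succAbove (i'.succAbove 0) ∨ l = i.succAbove (i'.succAbove 1) := by
  by_cases h : l = i
  · exact Or.inl h
  · obtain ⟨j, hj⟩ := Fin.exists_succAbove_eq h
    rcases fin_three_eq_or_succAbove j i' with hj' | hj' | hj'
    · exact Or.inr (Or.inl (by rw [← hj, hj']))
    · exact Or.inr (Or.inr (Or.inl (by rw [← hj, hj'])))
    · exact Or.inr (Or.inr (Or.inr (by rw [← hj, hj'])))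

set_option maxHeartbeats 2000000 in -- one long assembly: five named slots, two structural cases, four peeled slots each
/-- **(EQ-5) on every 5-family of increasing events with a `Z_4` sub-family** (pointwise, `p` in the open cube): if the four events other
than `U_m` form a zero flag of order `4` then `E_5(μ_p; 1_{U_0},…,1_{U_4}) = 0 ↔ U ∈ Z_5`.  Together with
`sahiE_five_ind_nonneg_of_zeroFlagQuadruple` this is the order-five step of the master conjecture with no input of lower order. [this work] -/
theorem sahiE_five_ind_eq_zero_iff_of_zeroFlagQuadruple (p : ι → unitInterval) (hp : ∀ e, (p e : ℝ) ∈ Set.Ioo (0 : ℝ) 1)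
    (U : Fin 5 → Set (Set ι)) (hU : ∀ j, IsUpperSet (U j)) (m : Fin 5) (hZ : SuppZeroFlag 4 (fun j => U (m.succAbove j))) :
    sahiE (bernoulliWeight p) 5 (fun j => ind (U j)) = 0 ↔ SuppZeroFlag 5 U := by
  refine ⟨fun h0 => ?_, fun h => sahiE_ind_eq_zero_of_suppZeroFlag p h⟩
  have hZ4 := hZ
  obtain ⟨i, hZ3, -⟩ := hZ
  obtain ⟨i', h1, h2, h3⟩ := (suppZeroFlag_three_iff_exists _).1 hZ3
  set D := U (m.succAbove i) with hDdef
  set G := U (m.succAbove (i.succAbove i')) with hGdef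
  set X := U (m.succAbove (i.succAbove (i'.succAbove 0))) with hXdef
  set Y := U (m.succAbove (i.succAbove (i'.succAbove 1))) with hYdef
  have hW : IsUpperSet (U m) := hU m; have hD : IsUpperSet D := hU _; have hG : IsUpperSet G := hU _
  have hX : IsUpperSet X := hU _; have hY : IsUpperSet Y := hU _
  -- degenerate members: an empty member puts `U` in `Z_5`
  rcases Set.eq_empty_or_nonempty X with hX0 | hXne
  · exact suppZeroFlag_of_mem_empty 4 U _ hX0
  rcases Set.eq_empty_or_nonempty Y with hY0 | hYne
  · exact suppZeroFlag_of_mem_empty 4 U _ hY0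
  rcases Set.eq_empty_or_nonempty G with hG0 | hGne
  · exact suppZeroFlag_of_mem_empty 4 U _ hG0
  -- the `Z_4` structure
  have hZV : ZVia X Y G := ⟨h1, h2, h3⟩
  set K : Set (Set ι) := {ω : Set ι | ω ∪ ↑(esupp X ∪ esupp Y) ∈ G} with hK
  have e4 : sahiE (bernoulliWeight p) 4 ![ind G, ind D, ind X, ind Y] = 0 := by
    have z := sahiE_ind_eq_zero_of_suppZeroFlag p hZ4
    rwa [sahiE_four_reindex _ _ i i'] at z
  obtain ⟨F1, F2, F3, F4⟩ := supports_of_sahiE_four_eq_zero p hp hX hY hG hD hXne hYne hZV K hK e4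
  have hKu : IsUpperSet K := isUpperSet_forcedHull hG _
  have hGK : G ⊆ K := subset_forcedHull hG _
  have hXG : X ∩ G = X ∩ K := sandwich_left hX hY hG hYne hZV
  have hYG : Y ∩ G = Y ∩ K := sandwich_right hX hY hG hXne hZV
  have dXY : Disjoint (esupp X) (esupp Y) := (suppZeroFlag_two_iff hX hY).1 h1
  have dXK : Disjoint (esupp X) (esupp K) := Finset.disjoint_left.2 fun e heX heK =>
    forall_not_affects_forcedHull_left X Y G e (mem_esupp.1 heX) (mem_esupp.1 heK)
  have dYK : Disjoint (esupp Y) (esupp K) := Finset.disjoint_left.2 fun e heY heK =>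
    forall_not_affects_forcedHull_right X Y G e (mem_esupp.1 heY) (mem_esupp.1 heK)
  have sXG : ∀ {X' : Set (Set ι)}, X' ⊆ X → X' ∩ K ⊆ G := fun hX' ω hω =>
    ((Set.ext_iff.1 hXG ω).2 ⟨hX' hω.1, hω.2⟩).2
  have sYG : ∀ {Y' : Set (Set ι)}, Y' ⊆ Y → Y' ∩ K ⊆ G := fun hY' ω hω =>
    ((Set.ext_iff.1 hYG ω).2 ⟨hY' hω.1, hω.2⟩).2
  -- slot bookkeeping
  have ne_G : i.succAbove i' ≠ i := Fin.succAbove_ne i i'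
  have ne_X : i.succAbove (i'.succAbove 0) ≠ i := Fin.succAbove_ne i _
  have ne_Y : i.succAbove (i'.succAbove 1) ≠ i := Fin.succAbove_ne i _
  have ne_GX : i.succAbove i' ≠ i.succAbove (i'.succAbove 0) := fun h =>
    Fin.succAbove_ne i' 0 (Fin.succAbove_right_injective h).symm
  have ne_GY : i.succAbove i' ≠ i.succAbove (i'.succAbove 1) := fun h =>
    Fin.succAbove_ne i' 1 (Fin.succAbove_right_injective h).symm
  have ne_XY : i.succAbove (i'.succAbove 0) ≠ i.succAbove (i'.succAbove 1) := fun h =>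
    succAbove_zero_ne_succAbove_one i' (Fin.succAbove_right_injective h)
  -- the peel at `m`
  have step := sahiE_ind_step p U m hZ4
  -- the two slots that need no case distinction: `l = i` (the `Z_3` triple is untouched)
  have keyD : 0 ≤ sahiE (bernoulliWeight p) 4
        (fun j => ind (update (fun j => U (m.succAbove j)) i (U (m.succAbove i) ∩ U m) j)) ∧
      (sahiE (bernoulliWeight p) 4 (fun j => ind (update (fun j => U (m.succAbove j)) i (U (m.succAbove i) ∩ U m) j)) = 0 →
        SuppZeroFlag 4 (update (fun j => U (m.succAbove j)) i (U (m.succAbove i) ∩ U m))) := by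
    have hF : ∀ j, IsUpperSet (update (fun j => U (m.succAbove j)) i (U (m.succAbove i) ∩ U m) j) :=
      isUpperSet_update_inter hU m i
    have hZ3' : SuppZeroFlag 3 (fun j => update (fun j => U (m.succAbove j)) i (U (m.succAbove i) ∩ U m) (i.succAbove j)) := by
      have : (fun j => update (fun j => U (m.succAbove j)) i (U (m.succAbove i) ∩ U m) (i.succAbove j)) =
          fun j => U (m.succAbove (i.succAbove j)) := by
        funext j; exact update_of_ne (Fin.succAbove_ne i j) _ _
      rw [this]; exact hZ3
    exact ⟨sahiE_four_ind_nonneg_of_zeroFlagTriple p _ hF i hZ3',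
      fun h => (sahiE_four_ind_eq_zero_iff_of_zeroFlagTriple p hp _ hF i hZ3').1 h⟩
  rcases F4 with hKG | ⟨F5, F6⟩
  · -- case (a): `G = K` is a frame member; `D` is pairwise-sandwiched with hull `K_D`
    rw [hKG] at dXK dYK F3
    set KD : Set (Set ι) := {ω : Set ι | ω ∪ ↑(esupp X ∪ esupp Y ∪ esupp G) ∈ D} with hKD
    have hKDu : IsUpperSet KD := isUpperSet_forcedHull hD _
    have hDKD : D ⊆ KD := subset_forcedHull hD _
    obtain ⟨sXK, sYK, sXY⟩ := inter_inter_hull_subset hX hY hG hD hXne hYne hGne F1 F2 F3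
    have nKD : ∀ {Z : Set (Set ι)} {e : ι}, Affects Z e → e ∈ esupp X ∪ esupp Y ∪ esupp G → ¬ Affects KD e :=
      fun _ he hK' => not_affects_forcedHull D (mem_coe.2 he) hK'
    have dKDX : Disjoint (esupp KD) (esupp X) := Finset.disjoint_left.2 fun e heKD heX =>
      nKD (mem_esupp.1 heX) (by simp [heX]) (mem_esupp.1 heKD)
    have dKDY : Disjoint (esupp KD) (esupp Y) := Finset.disjoint_left.2 fun e heKD heY =>
      nKD (mem_esupp.1 heY) (by simp [heY]) (mem_esupp.1 heKD)
    have dKDG : Disjoint (esupp KD) (esupp G) := Finset.disjoint_left.2 fun e heKD heG =>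
      nKD (mem_esupp.1 heG) (by simp [heG]) (mem_esupp.1 heKD)
    have key : ∀ l : Fin 4,
        0 ≤ sahiE (bernoulliWeight p) 4 (fun j => ind (update (fun j => U (m.succAbove j)) l (U (m.succAbove l) ∩ U m) j)) ∧
        (sahiE (bernoulliWeight p) 4 (fun j => ind (update (fun j => U (m.succAbove j)) l (U (m.succAbove l) ∩ U m) j)) = 0 →
          SuppZeroFlag 4 (update (fun j => U (m.succAbove j)) l (U (m.succAbove l) ∩ U m))) := by
      intro l
      have hF : ∀ j, IsUpperSet (update (fun j => U (m.succAbove j)) l (U (m.succAbove l) ∩ U m) j) :=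
        isUpperSet_update_inter hU m l
      have reidx := sahiE_four_reindex (bernoulliWeight p)
        (fun j => ind (update (fun j => U (m.succAbove j)) l (U (m.succAbove l) ∩ U m) j)) i i'
      rcases fin_four_slot_cases l i i' with hl | hl | hl | hl
      · have hl' := hl.symm
        subst hl'
        exact keyD
      · -- `G = K` is shrunk to `G ∩ W`: pairwise-shrunk frame `(K_D, X, Y)` with free member `G ∩ W`
        subst hl
        refine nonneg_and_zeroFlag_of_pairwise_shrink_at p hp _ hF i (i.succAbove (i'.succAbove 0)) (i.succAbove i')
          (i.succAbove (i'.succAbove 1)) ne_X.symm ne_G.symm ne_Y.symm ne_GX.symm ne_XY ne_GY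
          (update_of_ne ne_G.symm _ _) (update_of_ne ne_GX.symm _ _) (update_self _ _ _) (update_of_ne ne_GY.symm _ _)
          ?_ hKDu hX (hG.inter hW) hY dKDX dKDY dXY hDKD ?_ ?_ ?_
        · rw [reidx]
          simp only [update_self, update_of_ne ne_G.symm, update_of_ne ne_GX.symm, update_of_ne ne_GY.symm]
          exact sahiE_four_of_perm _ _ _ (Equiv.swap 1 2 * Equiv.swap 0 1) fun j => by fin_cases j <;> rfl
        · intro ω hω; exact sYK ⟨⟨hω.1.2, hω.1.1.1⟩, hω.2⟩
        · intro ω hω; exact sXK ⟨⟨hω.1.2, hω.1.1.1⟩, hω.2⟩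
        · intro ω hω; exact sXY ⟨⟨hω.1.2, hω.1.1⟩, hω.2⟩
      · -- `X` is shrunk to `X ∩ W`: pairwise-shrunk frame `(K_D, G, Y)` with free member `X ∩ W`
        subst hl
        refine nonneg_and_zeroFlag_of_pairwise_shrink_at p hp _ hF i (i.succAbove i') (i.succAbove (i'.succAbove 0))
          (i.succAbove (i'.succAbove 1)) ne_G.symm ne_X.symm ne_Y.symm ne_GX ne_GY ne_XY
          (update_of_ne ne_X.symm _ _) (update_of_ne ne_GX _ _) (update_self _ _ _) (update_of_ne ne_XY.symm _ _)
          ?_ hKDu hG (hX.inter hW) hY dKDG dKDY dYK.symm hDKD ?_ ?_ ?_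
        · rw [reidx]
          simp only [update_self, update_of_ne ne_X.symm, update_of_ne ne_GX, update_of_ne ne_XY.symm]
          exact sahiE_four_of_perm _ _ _ (Equiv.swap 0 1) fun j => by fin_cases j <;> rfl
        · intro ω hω; exact sXY ⟨⟨hω.1.1.1, hω.1.2⟩, hω.2⟩
        · intro ω hω; exact sXK ⟨⟨hω.1.1.1, hω.1.2⟩, hω.2⟩
        · intro ω hω; exact sYK ⟨⟨hω.1.1, hω.1.2⟩, hω.2⟩
      · -- `Y` is shrunk to `Y ∩ W`: the same with the roles of `X` and `Y` exchanged
        subst hl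
        refine nonneg_and_zeroFlag_of_pairwise_shrink_at p hp _ hF i (i.succAbove i') (i.succAbove (i'.succAbove 1))
          (i.succAbove (i'.succAbove 0)) ne_G.symm ne_Y.symm ne_X.symm ne_GY ne_GX ne_XY.symm
          (update_of_ne ne_Y.symm _ _) (update_of_ne ne_GY _ _) (update_self _ _ _) (update_of_ne ne_XY _ _)
          ?_ hKDu hG (hY.inter hW) hX dKDG dKDX dXK.symm hDKD ?_ ?_ ?_
        · rw [reidx]
          simp only [update_self, update_of_ne ne_Y.symm, update_of_ne ne_GY, update_of_ne ne_XY]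
          exact sahiE_four_of_perm _ _ _ (Equiv.swap 0 1 * Equiv.swap 2 3) fun j => by fin_cases j <;> rfl
        · intro ω hω; exact sXY ⟨⟨hω.1.2, hω.1.1.1⟩, hω.2⟩
        · intro ω hω; exact sYK ⟨⟨hω.1.1.1, hω.1.2⟩, hω.2⟩
        · intro ω hω; exact sXK ⟨⟨hω.1.1, hω.1.2⟩, hω.2⟩
    rw [step] at h0
    have hall := (Finset.sum_eq_zero_iff_of_nonneg fun l _ => (key l).1).1 h0
    exact ⟨m, hZ4, fun l => (key l).2 (hall l (Finset.mem_univ l))⟩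
  · -- case (b): `D` is `Z_3`-sandwiched over `(X, Y)` as well, with hull `K'` independent of `K`
    have hZD : ZVia X Y D :=
      ⟨h1, (suppZeroFlag_two_iff (hX.inter hD) hY).2 F5, (suppZeroFlag_two_iff hX (hY.inter hD)).2 F6⟩
    set K' : Set (Set ι) := {ω : Set ι | ω ∪ ↑(esupp X ∪ esupp Y) ∈ D} with hK'
    have hK'u : IsUpperSet K' := isUpperSet_forcedHull hD _
    have hDK' : D ⊆ K' := subset_forcedHull hD _
    have hXD : X ∩ D = X ∩ K' := sandwich_left hX hY hD hYne hZD
    have hYD : Y ∩ D = Y ∩ K' := sandwich_right hX hY hD hXne hZD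
    have dXK' : Disjoint (esupp X) (esupp K') := Finset.disjoint_left.2 fun e heX heK =>
      forall_not_affects_forcedHull_left X Y D e (mem_esupp.1 heX) (mem_esupp.1 heK)
    have dYK' : Disjoint (esupp Y) (esupp K') := Finset.disjoint_left.2 fun e heY heK =>
      forall_not_affects_forcedHull_right X Y D e (mem_esupp.1 heY) (mem_esupp.1 heK)
    have dKK' : Disjoint (esupp K) (esupp K') := by
      have hsub : esupp K' ⊆ esupp (K' ∩ (X ∩ Y)) :=
        esupp_subset_esupp_inter hK'u (hX.inter hY) ⟨Set.univ, univ_mem_of_nonempty hX hXne, univ_mem_of_nonempty hY hYne⟩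
          (Finset.disjoint_of_subset_right (esupp_inter_subset X Y) (Finset.disjoint_union_right.2 ⟨dXK'.symm, dYK'.symm⟩))
      have heq : K' ∩ (X ∩ Y) = X ∩ Y ∩ D := by
        ext ω; constructor
        · rintro ⟨hK', hXω, hYω⟩
          exact ⟨⟨hXω, hYω⟩, ((Set.ext_iff.1 hXD ω).2 ⟨hXω, hK'⟩).2⟩
        · rintro ⟨⟨hXω, hYω⟩, hDω⟩
          exact ⟨hDK' hDω, hXω, hYω⟩
      rw [heq] at hsub
      exact Finset.disjoint_of_subset_right hsub F3
    have sXD : ∀ {X' : Set (Set ι)}, X' ⊆ X → X' ∩ K' ⊆ D := fun hX' ω hω =>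
      ((Set.ext_iff.1 hXD ω).2 ⟨hX' hω.1, hω.2⟩).2
    have sYD : ∀ {Y' : Set (Set ι)}, Y' ⊆ Y → Y' ∩ K' ⊆ D := fun hY' ω hω =>
      ((Set.ext_iff.1 hYD ω).2 ⟨hY' hω.1, hω.2⟩).2
    have key : ∀ l : Fin 4,
        0 ≤ sahiE (bernoulliWeight p) 4 (fun j => ind (update (fun j => U (m.succAbove j)) l (U (m.succAbove l) ∩ U m) j)) ∧
        (sahiE (bernoulliWeight p) 4 (fun j => ind (update (fun j => U (m.succAbove j)) l (U (m.succAbove l) ∩ U m) j)) = 0 →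
          SuppZeroFlag 4 (update (fun j => U (m.succAbove j)) l (U (m.succAbove l) ∩ U m))) := by
      intro l
      have hF : ∀ j, IsUpperSet (update (fun j => U (m.succAbove j)) l (U (m.succAbove l) ∩ U m) j) :=
        isUpperSet_update_inter hU m l
      have reidx := sahiE_four_reindex (bernoulliWeight p)
        (fun j => ind (update (fun j => U (m.succAbove j)) l (U (m.succAbove l) ∩ U m) j)) i i'
      rcases fin_four_slot_cases l i i' with hl | hl | hl | hl
      · have hl' := hl.symm
        subst hl'
        exact keyD
      · -- `G` is shrunk; the `Z_3` triple `(X, Y, D)` is untouched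
        subst hl
        have hZ3' : SuppZeroFlag 3 (fun j => update (fun j => U (m.succAbove j)) (i.succAbove i')
            (U (m.succAbove (i.succAbove i')) ∩ U m) ((i.succAbove i').succAbove j)) := by
          refine suppZeroFlag_three_succAbove_of_vec _ (i.succAbove i') (i.succAbove (i'.succAbove 0))
            (i.succAbove (i'.succAbove 1)) i ne_GX.symm ne_GY.symm ne_G.symm ne_XY ne_X ne_Y ?_
          simp only [update_of_ne ne_GX.symm, update_of_ne ne_GY.symm, update_of_ne ne_G.symm]
          exact (suppZeroFlag_three_iff_zVia X Y D).2 (Or.inr (Or.inr hZD))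
        exact ⟨sahiE_four_ind_nonneg_of_zeroFlagTriple p _ hF _ hZ3',
          fun h => (sahiE_four_ind_eq_zero_iff_of_zeroFlagTriple p hp _ hF _ hZ3').1 h⟩
      · -- `X` is shrunk to `X ∩ W`: two shrunk slots `G ⊆ K`, `D ⊆ K'` over the frame `(Y, K, K')`
        subst hl
        refine nonneg_and_zeroFlag_of_two_shrinks_at p hp _ hF (i.succAbove i') i (i.succAbove (i'.succAbove 0))
          (i.succAbove (i'.succAbove 1)) ne_G ne_GX ne_GY ne_X.symm ne_Y.symm ne_XY
          (update_of_ne ne_GX _ _) (update_of_ne ne_X.symm _ _) (update_self _ _ _) (update_of_ne ne_XY.symm _ _)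
          ?_ (hX.inter hW) hY hKu hK'u hYne dYK dYK' dKK' hGK hDK' (sXG Set.inter_subset_left) (sYG subset_rfl)
          (sXD Set.inter_subset_left) (sYD subset_rfl)
        rw [reidx]
        simp only [update_self, update_of_ne ne_GX, update_of_ne ne_X.symm, update_of_ne ne_XY.symm]
      · -- `Y` is shrunk to `Y ∩ W`: the same with the roles of `X` and `Y` exchanged
        subst hl
        refine nonneg_and_zeroFlag_of_two_shrinks_at p hp _ hF (i.succAbove i') i (i.succAbove (i'.succAbove 1))
          (i.succAbove (i'.succAbove 0)) ne_G ne_GY ne_GX ne_Y.symm ne_X.symm ne_XY.symm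
          (update_of_ne ne_GY _ _) (update_of_ne ne_Y.symm _ _) (update_self _ _ _) (update_of_ne ne_XY _ _)
          ?_ (hY.inter hW) hX hKu hK'u hXne dXK dXK' dKK' hGK hDK' (sYG Set.inter_subset_left) (sXG subset_rfl)
          (sYD Set.inter_subset_left) (sXD subset_rfl)
        rw [reidx]
        simp only [update_self, update_of_ne ne_GY, update_of_ne ne_Y.symm, update_of_ne ne_XY]
        exact sahiE_four_of_perm _ _ _ (Equiv.swap 2 3) fun j => by fin_cases j <;> rfl
    rw [step] at h0
    have hall := (Finset.sum_eq_zero_iff_of_nonneg fun l _ => (key l).1).1 h0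
    exact ⟨m, hZ4, fun l => (key l).2 (hall l (Finset.mem_univ l))⟩

/-- **The order-five step of the master conjecture, unconditionally**: for five increasing events such that the four events other
than `U_m` form a zero flag of order `4`, `E_5(μ_p; 1_U) ≥ 0` for every `p ∈ [0,1]^ι` and, for `p` in the open cube,
`E_5(μ_p; 1_U) = 0 ↔ U ∈ Z_5` — `masterFamily_step` at `k = 5` with its hypotheses `MasterFamilyNonneg 4`, `MasterFamilyEqIff 4`
removed. [this work] -/
theorem masterFamily_step_five (p : ι → unitInterval) (hp : ∀ e, (p e : ℝ) ∈ Set.Ioo (0 : ℝ) 1) (U : Fin 5 → Set (Set ι))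
    (hU : ∀ j, IsUpperSet (U j)) (m : Fin 5) (hZ : SuppZeroFlag 4 (fun j => U (m.succAbove j))) :
    0 ≤ sahiE (bernoulliWeight p) 5 (fun j => ind (U j)) ∧
      (sahiE (bernoulliWeight p) 5 (fun j => ind (U j)) = 0 ↔ SuppZeroFlag 5 U) :=
  ⟨sahiE_five_ind_nonneg_of_zeroFlagQuadruple p U hU m hZ, sahiE_five_ind_eq_zero_iff_of_zeroFlagQuadruple p hp U hU m hZ⟩

end Events

/-! ### Consequences for the master statements of order five -/

/-- **`MasterFamilyEqIff 5` ⟺ "an interior zero of `E_5` forces a `Z_4` sub-family".** [this work] -/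
theorem masterFamilyEqIff_five_iff :
    MasterFamilyEqIff 5 ↔ ∀ (ι : Type) [Fintype ι] (p : ι → unitInterval), (∀ e, (p e : ℝ) ∈ Set.Ioo (0 : ℝ) 1) →
      ∀ U : Fin 5 → Set (Set ι), (∀ j, IsUpperSet (U j)) →
        sahiE (bernoulliWeight p) 5 (fun j => ind (U j)) = 0 →
          ∃ m : Fin 5, SuppZeroFlag 4 (fun j => U (m.succAbove j)) := by
  refine ⟨fun hE ι _ p hp U hU h0 => ?_, fun hH ι _ p hp U hU => ⟨fun h0 => ?_, masterFamilyEqIff_mpr 5 ι p U⟩⟩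
  · obtain ⟨m, hm, -⟩ := (hE ι p hp U hU).1 h0
    exact ⟨m, hm⟩
  · obtain ⟨m, hm⟩ := hH ι p hp U hU h0
    exact (sahiE_five_ind_eq_zero_iff_of_zeroFlagQuadruple p hp U hU m hm).1 h0

/-- **(EQI-5) ⟺ (T₅)**: the identically-zero form `MasterFamilyIdentEqIff 5` is equivalent to "five increasing events with NO `Z_4`
sub-family have `E_5(μ_p) ≠ 0` for some interior `p`" — 5-families with a `Z_4` sub-family are settled by
`sahiE_five_ind_eq_zero_iff_of_zeroFlagQuadruple`. [this work] -/
theorem masterFamilyIdentEqIff_five_iff :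
    MasterFamilyIdentEqIff 5 ↔ ∀ (ι : Type) [Fintype ι] (U : Fin 5 → Set (Set ι)), (∀ j, IsUpperSet (U j)) →
      (∀ m : Fin 5, ¬ SuppZeroFlag 4 (fun j => U (m.succAbove j))) →
        ∃ p : ι → unitInterval, (∀ e, (p e : ℝ) ∈ Set.Ioo (0 : ℝ) 1) ∧
          sahiE (bernoulliWeight p) 5 (fun j => ind (U j)) ≠ 0 := by
  constructor
  · intro hI ι _ U hU hno
    by_contra hall
    push Not at hall
    obtain ⟨m, hm, -⟩ := (hI ι U hU).1 fun p hp => hall p hp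
    exact hno m hm
  · intro hT ι _ U hU
    refine ⟨fun hall => ?_, fun hZ p _ => masterFamilyIdentEqIff_mpr 5 ι U hZ p⟩
    by_cases hex : ∃ m : Fin 5, SuppZeroFlag 4 (fun j => U (m.succAbove j))
    · obtain ⟨m, hm⟩ := hex
      exact (sahiE_five_ind_eq_zero_iff_of_zeroFlagQuadruple (halfParams ι) (halfParams_mem_Ioo ι) U hU m hm).1
        (hall _ (halfParams_mem_Ioo ι))
    · push Not at hex
      obtain ⟨p, hp, hne⟩ := hT ι U hU hex
      exact absurd (hall p hp) hne

end Summit.CriticalPhenomena.PercolationContinuityZ3.Theorems
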